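import Summits.SmoothPoincare4.SmoothPoincare4.Theses.CylinderEntropy
import Literature.Geometry.Riemannian.LowEntropyHypersurfacesFourProofs
import Literature.Geometry.Riemannian.SphericalCylinderEntropy
import Literature.Geometry.Riemannian.SphericalCylinderSmallScaleDomination
import Summits.SmoothPoincare4.SmoothPoincare4.Theorems.CylinderEntropySliceIsolationStubConformalEmbedding
import Literature.Topology.FourManifolds.HomotopyS4CompactProofs
import Literature.Topology.FourManifolds.HomotopyS4SimplyConnected
import Literature.Topology.FourManifolds.SphereSimplyConnected
import HarnessLib
import HarnessLib.Audit

/-!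
# Line `conformal-kernel-domination` — crux `CylinderEntropy.SliceIsolation` (stmt-SmoothPoincare4-7632)

LEAD SKELETON (prover-line-stmt-SmoothPoincare4-7632-0, picked 2026-08-16; `PICKED.md`). Reshape r1 (lead):
the six registered stubs `stub_*` are now stated SELF-CONTAINED (no file-local abbreviation inside a registered
signature: `cylN`, `SeparatesEnds`, `InSlab`, `conformalMap` are spelled out, so that a stub worker's
`Theorems/CylinderEntropySliceIsolation<Stub>.lean` proves the registered text verbatim and the `--supports`
match is syntactic); the readable `Prop` abbreviations `ConformalEmbedding`, … are kept for the composition and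
are bridged to the registered statements by the definitional one-liners `*_iff_stub` below (kernel-checked
`Iff.rfl`). Stub ownership: lead = `stub_slabConfinement`; workers = `stub_conformalEmbedding`,
`stub_smallScaleDomination`, `stub_groundStateContinuity`, `stub_entropyDomination`; `stub_cmsLowEntropySphereFour`
= named classical debt (CMS 2025, tree fact), carried as the hypothesis of the eventual closing theorem.
Integration r2 (lead, after wave 1): STUB 1 LANDED (p74486, `Theorems/CylinderEntropySliceIsolationStubConformalEmbedding.lean`,
used below by name); STUB 3 PROVED MODULO a second named classical debt — the Cheeger–Yau near-diagonal lower bound for the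
typed zonal heat series of `S⁴`, tree fact `Literature.Geometry.Riemannian.CheegerYauZonalSphereFour` (p76567, with the
conditional theorem `SphericalCylinderConformal.smallScaleDomination_of_cheegerYau`, helpers p76252/p76254) — registered here
as `stub_cheegerYauZonalSphereFour` exactly like stub 0; helper files landed: `…ConformalMapLipschitz.lean` (p76043),
`…CentreDomination.lean` (p76772, the centre case `y = 0` of stub 5). Remaining `sorry`s: stub 0 (CMS debt), Cheeger–Yau debt,
stub 2 (lead), stub 4 (worker), stub 5 (sharp variant, off the main chain; general centre open, LP-certified numerically only).


Skeleton (crux-plan, round 1; planner-cruxplan-stmt-SmoothPoincare4-7632-conformal-kernel-dom-0,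
2026-08-15). Idea card `Cruxes/SliceIsolation/Ideas/conformal-kernel-domination.md` (ideator 2), triage
r1-1/2/3: pass ×3, with the common sharpening "plan the line on the SOFT lemma K2
(`ConformalEntropyContinuity`), keep the sharp kernel domination K1 as the explicit-constant bonus".

THE CRUX (route `CylinderEntropy`, rank 3): `∃ ε > 0`, every smooth embedding `ι` of a homotopy 4-sphere
`M` into `N = S⁴ × ℝ = {z ∈ ℝ⁶ | ∑_{i<5} zᵢ² = 1}` separating the two ends with typed cylinder entropy
`λ_cyl(range ι) < 1 + ε` has `M ≃ₘ S⁴`.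

THE LINE. The conformal diffeomorphism `Φ : N → ℝ⁵ ∖ {0}`, `Φ(x, s) = eˢ x` (`conformalMap`) sends
slices to round spheres centred at `0` — the ground state of the Colding–Minicozzi entropy among closed
hypersurfaces, `λ(S⁴) = 32/(3e²) = 1.4436` — and `Φ ∘ ι` is a smooth embedding of `M` into `ℝ⁵`
(`stub_conformalEmbedding`). If the Euclidean entropy of `Φ(range ι)` is `≤ λ(S² × ℝ²) = 4/e = 1.4715`,
the VENDORED theorem of Chodosh–Mantoulidis–Schulze (Duke 2025, Cor. 1.5 (b), `n = 4`; tree fact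
`ChodoshMantoulidisSchulze2025_lowEntropy_sphere_four`, clause (b), simply connected case) gives
`M ≃ₘ S⁴`. The free window is `[λ(S⁴), 4/e)`, of width `0.0279`; the line proves that cross-sections
with `λ_cyl < 1 + ε` land inside it, by three lemmas about the FIXED pair of spaces `(N, ℝ⁵)`:

* `stub_slabConfinement` (N-side geometry, the hardest): `λ_cyl ≤ 1 + ε` confines a compact
  connected end-separating smooth hypersurface of `N` to a slab `S⁴ × [t₀ − η, t₀ + η]`, `η → 0`
  with `ε` (area budget `vol S⁴ ≤ area ≤ (1+ε) vol S⁴` + coarea/isoperimetry on `S⁴` for the bulk;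
  thin fingers and films are excluded by their own small-scale cylinder densities
  `λ(S³ × ℝ) = 1.453`, resp. `2`);
* `stub_smallScaleDomination` (conformal matching below the conformal scale): for sets in a unit slab
  around height `t₀`, every Euclidean Gaussian area of `Φ(A)` at scale `t ≤ t₁ e^{2t₀}` is at most
  `(1+δ) λ_cyl(A)` — the pulled-back Euclidean kernel `(4πτ)⁻² e^{4u} e^{-|eᵘx − ŷ|²/4τ}` is
  dominated pointwise by `(1+δ')` times ONE cylinder kernel (centre shifted up by `8τ`, scale
  broadened by `1 + O(√(τ log τ⁻¹))`; Cheeger–Yau lower bound for the heat kernel of `S⁴`) plus a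
  `δ'`-multiple of the area kernel (`measure_ratio_le_cylEntropy`), total mass `→ 1` as `τ → 0`;
* `stub_groundStateContinuity` (unit and large scales): for end-separating sets in a THIN slab of
  height `η` around `t₀` with area `≤ (1+ε) μH⁴(S⁴)`, every Euclidean Gaussian area of `Φ(A)` at
  scale `t ≥ t₁ e^{2t₀}` is at most `λ(S⁴) + δ` — separation gives `π_#(𝓗⁴⌊A) ≥ 𝓗⁴⌊S⁴` for the
  1-Lipschitz shadow, so `𝓗⁴⌊A` is `(η + ε)`-close to the slice in bounded-Lipschitz distance, and the
  Euclidean kernels at scales `≥ t₁` are uniformly Lipschitz; large `t` / far `y` by the area bound.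

With `δ = 1/100` both regimes stay below `4/e` (`(1.01)(1+ε) ≤ 4/e`, `32/(3e²) + 1/100 ≤ 4/e`), so the
composition `sliceIsolation_of_parts` is numerical bookkeeping + the instances
`CompactSpace/ConnectedSpace/SimplyConnectedSpace M` from `M ≃ₕ S⁴` (all PROVED in the tree) + the CMS
fact; `SliceIsolation_of : SliceIsolation` concludes the crux BY NAME from the registered stubs 0–4, where
STUB 0 `stub_cmsLowEntropySphereFour` is the tree's NAMED FACT
`ChodoshMantoulidisSchulze2025_lowEntropy_sphere_four` kept as a registered stub (named classical debt,
so that the skeleton has no unregistered hypothesis; the lead's closing theorem should carry it as the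
hypothesis `(h : ChodoshMantoulidisSchulze2025_lowEntropy_sphere_four)` — `sliceIsolation_of_parts` has
exactly that shape).

THE SHARP VARIANT (K1 of the card, registered as `stub_entropyDomination`, NOT on the main chain):
`λ(Φ A) ≤ λ(S⁴) · λ_cyl(A)` for every measurable `A ⊆ N`; `SliceIsolation_of_domination` turns it (with
STUBS 0, 1) into the crux with the EXPLICIT `1 + ε = 3e/8 = 1.01936`
(`(32/(3e²)) · (3e/8) = 4/e`). Proved by hand at the centre `y = 0` (card; triage r1-1/2/3 re-derived it),
supported to second order at the ground state and by the terrace test `T(η) ≤ 1` (TRIAGE-r1-3-numerics);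
open in the regime `|y|²/τ ≈ 8–30`.

DISPROOF USED (standing disprover refuter-cdisprove-stmt-SmoothPoincare4-7632-0, `Disproof.lean` stage 6 —
its body is not mounted on this hub; read through its six evidence notes and its two LANDED support files
`Literature/Geometry/Manifold/CylinderSlice.lean` (p68516) and
`Literature/Geometry/Riemannian/SphericalCylinderEntropy.lean` (p69001), whose `cylEntropy` IS the route's
`⨆` verbatim and is used below): (i) `0 < ε` is load-bearing (`sliceIsolationAt_of_nonpos`, tightness
`∀ ε ≤ 0`) — the composition produces `ε = min(ε_unit, ε_slab, 1/100) > 0`, resp. `3e/8 − 1 > 0`;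
(ii) `M ≃ₕ S⁴` is load-bearing as compactness + connectedness (near-miss "slice ⊔ dust") — used EXACTLY
for the instances the CMS fact demands (`compactSpace_of_homotopyEquiv_sphere_four_holds`,
`pathConnectedSpace_of_homotopyEquiv`, `simplyConnectedSpace_of_homotopyEquiv_sphere_four`) and for
`[CompactSpace M] [ConnectedSpace M]` in `stub_slabConfinement`; (iii) `IsSmoothEmbedding` is load-bearing
(`smoothPoincare4_of_sliceIsolationWithoutEmbedding`: without it the crux is SPC4) — smoothness enters at
`stub_conformalEmbedding` → CMS and nowhere else; (iv) calibration / entropy floor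
(`one_le_cylEntropy_slice`, `one_le_cylEntropy_of_separatesEnds`, `measure_ratio_le_cylEntropy`) — the
large-scale end of the domination is exactly the area kernel, used in the composition (area budget) and
inside `stub_smallScaleDomination`; no stub asserts anything about slices that the floor contradicts
(slices: `λ_cyl = 1`, `Φ(slice)` = round sphere, equality case of every stub). No `_false_without_`
theorem is contradicted; no `Negative/` lemma has landed for this crux (checked `ledger crux ls`,
2026-08-15T23:5xZ); negatives index for SmoothPoincare4: empty.
-/

noncomputable section

open MeasureTheory Set
open scoped Manifold ContDiff ENNReal Topology BigOperators ContinuousMap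

namespace Summit.SmoothPoincare4.SmoothPoincare4.Cruxes.SliceIsolation.ConformalKernelDomination

open Literature.Geometry.Riemannian
open Literature.Geometry.Riemannian.SphericalCylinderEntropy (cylKernel cylDensity cylEntropy
  measure_ratio_le_cylEntropy hausdorffMeasure_sphere_four_pos hausdorffMeasure_sphere_four_lt_top)
open Summit.SmoothPoincare4.SmoothPoincare4.Theses.CylinderEntropy (SliceIsolation)

set_option linter.dupNamespace false

local notation "E5" => EuclideanSpace ℝ (Fin 5)
local notation "E6" => EuclideanSpace ℝ (Fin 6)

/-! ## The objects -/

/-- The round cylinder `N = S⁴ × ℝ ⊂ ℝ⁶`, exactly as typed in the route items. -/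
def cylN : Set E6 := {z | ∑ i : Fin 5, z (Fin.castSucc i) ^ 2 = 1}

/-- The typed end-separation predicate of the route items: no path in `N ∖ A` from height `≤ -R` to
height `≥ R`. -/
def SeparatesEnds (A : Set E6) : Prop :=
  ∃ R : ℝ, ∀ a b : E6, ∑ i : Fin 5, a (Fin.castSucc i) ^ 2 = 1 → ∑ i : Fin 5, b (Fin.castSucc i) ^ 2 = 1 →
    a 5 ≤ -R → R ≤ b 5 →
      ¬ JoinedIn ({z : EuclideanSpace ℝ (Fin 6) | ∑ i : Fin 5, z (Fin.castSucc i) ^ 2 = 1} \ A) a b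

/-- `A` lies in the slab `S⁴ × [t₀ - η, t₀ + η]` (one-sided Hausdorff closeness to the slice at height
`t₀`). -/
def InSlab (A : Set E6) (t₀ η : ℝ) : Prop := ∀ z ∈ A, |z 5 - t₀| ≤ η

/-- The conformal diffeomorphism `Φ : N → ℝ⁵ ∖ {0}`, `Φ(x, s) = eˢ x`, written on all of `ℝ⁶`
(polynomial-exponential, hence smooth on `ℝ⁶`; on `N` its differential is `eˢ` times an isometry
`T_z N → ℝ⁵`, i.e. `Φ|_N` is conformal with factor `eˢ`, and slices go to round spheres about `0`). -/
def conformalMap (z : E6) : E5 :=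
  WithLp.toLp 2 (fun i : Fin 5 => Real.exp (z 5) * z (Fin.castSucc i))

/-! ## Statements of the stubs -/

/-- Statement of `stub_conformalEmbedding` (differential topology, size M): for a compact `4`-manifold
`M` and a smooth embedding `ι : M → ℝ⁶` with image in `N`, `Φ ∘ ι : M → ℝ⁵` is a smooth embedding
(`Φ|_N` is an injective immersion — conformal differential — and `M` is compact: the tree's immersion
criterion `isSmoothEmbedding_of_injective_of_injective_mfderiv`). -/
def ConformalEmbedding : Prop :=
  ∀ (M : Type) [TopologicalSpace M] [T2Space M] [SecondCountableTopology M]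
    [ChartedSpace (EuclideanSpace ℝ (Fin 4)) M] [IsManifold (𝓡 4) ∞ M] [CompactSpace M]
    (ι : M → E6), Manifold.IsSmoothEmbedding (𝓡 4) (𝓡 6) ∞ ι →
    (∀ x, ∑ i : Fin 5, ι x (Fin.castSucc i) ^ 2 = 1) →
    Manifold.IsSmoothEmbedding (𝓡 4) (𝓡 5) ∞ (conformalMap ∘ ι)

/-- Statement of `stub_slabConfinement` (N-side geometry, size L — the hardest stub): Hausdorff
stability of the slice among cross-sections. For every `η > 0` there is `ε > 0` such that a compact
connected smooth hypersurface of `N` separating the ends with typed cylinder entropy `≤ 1 + ε` lies in a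
slab of half-height `η`. (Area budget `μH⁴(S⁴) ≤ μH⁴(range ι) ≤ (1+ε) μH⁴(S⁴)` from
`hausdorffMeasure_sphere_le_of_separatesEnds` / `measure_ratio_le_cylEntropy`; coarea + isoperimetry on
`S⁴` for the bulk; thin fingers / films have cylinder density `≈ λ(S³ × ℝ) = 1.453`, resp. `2`, at their
own scale `< inj N`, so small-area far excursions are excluded by the hypothesis itself.) -/
def SlabConfinement : Prop :=
  ∀ η : ℝ, 0 < η → ∃ ε : ℝ, 0 < ε ∧
    ∀ (M : Type) [TopologicalSpace M] [T2Space M] [SecondCountableTopology M]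
      [ChartedSpace (EuclideanSpace ℝ (Fin 4)) M] [IsManifold (𝓡 4) ∞ M] [CompactSpace M]
      [ConnectedSpace M] (ι : M → E6), Manifold.IsSmoothEmbedding (𝓡 4) (𝓡 6) ∞ ι →
      (∀ x, ∑ i : Fin 5, ι x (Fin.castSucc i) ^ 2 = 1) → SeparatesEnds (Set.range ι) →
      cylEntropy (Set.range ι) ≤ ENNReal.ofReal (1 + ε) →
      ∃ t₀ : ℝ, InSlab (Set.range ι) t₀ η

/-- Statement of `stub_smallScaleDomination` (kernel comparison on the fixed pair `(N, ℝ⁵)`, size M–L):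
for every `δ > 0` there is `t₁ > 0` such that for every measurable `A ⊆ N` in a unit slab around height
`t₀`, every centre `y ∈ ℝ⁵` and every scale `0 < t ≤ t₁ e^{2t₀}`,
`F_{y,t}(Φ A) ≤ (1 + δ) λ_cyl(A)`. (By the `s`-shift / dilation symmetry `t₀ = 0`, `|y| = 1`: the
pulled-back kernel is `(4πτ)⁻² e^{4u} exp(−((eᵘ − 1)² + 2eᵘ(1 − cos θ))/4τ)`; it is dominated by
`(1+δ')` × the Cheeger–Yau minorant of ONE cylinder kernel centred at `(ŷ, 8τ)` with scale
`τ(1 + κ_τ)`, `κ_τ = O(√(τ log τ⁻¹))`, plus `δ'/vol(S⁴)`, and the constant kernel integrates to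
`μH⁴(A)/μH⁴(S⁴) ≤ λ_cyl(A)` by `measure_ratio_le_cylEntropy`; `μH⁴⌊Φ(A) ≤ Φ_#(e^{4s}(1+o(1)) μH⁴⌊A)`
by local Lipschitz control of `Φ|_N`.) -/
def SmallScaleDomination : Prop :=
  ∀ δ : ℝ, 0 < δ → ∃ t₁ : ℝ, 0 < t₁ ∧
    ∀ (t₀ : ℝ) (A : Set E6), A ⊆ cylN → MeasurableSet A → InSlab A t₀ 1 →
      ∀ (y : E5) (t : ℝ), 0 < t → t ≤ t₁ * Real.exp (2 * t₀) →
        gaussianArea 4 y t (conformalMap '' A) ≤ ENNReal.ofReal (1 + δ) * cylEntropy A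

/-- Statement of `stub_groundStateContinuity` (measure theory on the fixed pair `(N, ℝ⁵)`, size M–L):
continuity of the Euclidean Gaussian areas at the ground state, at unit and large scales. For every
`δ > 0` and `t₁ > 0` there are `η > 0`, `ε > 0` such that for every measurable end-separating `A ⊆ N`
in the slab of half-height `η` around `t₀` with `μH⁴(A) ≤ (1+ε) μH⁴(S⁴)`, every centre `y` and every
scale `t ≥ t₁ e^{2t₀}`, `F_{y,t}(Φ A) ≤ λ(unit S⁴) + δ`. (`t₀ = 0` by dilation; separation gives
`π_#(μH⁴⌊A) ≥ μH⁴⌊S⁴` for the 1-Lipschitz shadow `π`, so `μH⁴⌊A = ` slice `+` a measure of mass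
`≤ ε μH⁴(S⁴)`, moved by `≤ η`; the kernels `(4πt)⁻² e^{-|w−y|²/4t}`, `t ≥ t₁`, are uniformly bounded
and Lipschitz; `F_{y,t}(unit S⁴) ≤ λ(S⁴)`.) -/
def GroundStateContinuity : Prop :=
  ∀ δ : ℝ, 0 < δ → ∀ t₁ : ℝ, 0 < t₁ → ∃ η : ℝ, 0 < η ∧ ∃ ε : ℝ, 0 < ε ∧
    ∀ (t₀ : ℝ) (A : Set E6), A ⊆ cylN → MeasurableSet A → SeparatesEnds A → InSlab A t₀ η →
      μH[4] A ≤ ENNReal.ofReal (1 + ε) * μH[4] (Metric.sphere (0 : E5) 1) →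
      ∀ (y : E5) (t : ℝ), t₁ * Real.exp (2 * t₀) ≤ t →
        gaussianArea 4 y t (conformalMap '' A) ≤
          gaussianEntropy 4 (Metric.sphere (0 : E5) 1) + ENNReal.ofReal δ

/-- Statement of `stub_entropyDomination` — THE SHARP VARIANT (K1 of the card; transfer target `C⁺`;
NOT on the main chain): the Colding–Minicozzi entropy of the conformal image of any measurable
`A ⊆ N` is at most `λ(unit S⁴) · λ_cyl(A)` (`λ(S⁴) = 32/(3e²)`). Equality on slices; proved by hand at
the centre `y = 0` (`max_s (4πτ)⁻² vol(S⁴) e^{4s − e^{2s}/4τ} = 32/(3e²)`); conjectured via pointwise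
domination of the pulled-back Euclidean kernels by superpositions of cylinder kernels of total mass
`λ(S⁴)` (an LP per value of `|y|²/τ`). -/
def EntropyDomination : Prop :=
  ∀ A : Set E6, A ⊆ cylN → MeasurableSet A →
    gaussianEntropy 4 (conformalMap '' A) ≤ gaussianEntropy 4 (Metric.sphere (0 : E5) 1) * cylEntropy A

/-! ## Registered stubs (self-contained statements; `sorry` only here) -/

/-- STUB 0 · NAMED CLASSICAL DEBT: the tree's named fact (statement only, D-0014)
`ChodoshMantoulidisSchulze2025_lowEntropy_sphere_four` — Chodosh–Mantoulidis–Schulze, Duke Math. J. 2025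
(arXiv:2309.03856), Cor. 1.5 (a), (b) = Cor. 1.22 for `n = 4` (clause (b) is used: a simply connected
closed embedded hypersurface of `ℝ⁵` with `λ ≤ λ(S²(2) × ℝ²) = 4/e` is diffeomorphic to `S⁴`). Kept as a
registered stub only so that the skeleton theorem has no unregistered hypothesis; it is NOT a lemma to
prove — the closing theorem of the line carries it as a hypothesis by name (`sliceIsolation_of_parts`).
[cite: ChodoshMantoulidisSchulze2025, Cor. 1.5 (b)] -/
theorem stub_cmsLowEntropySphereFour : ChodoshMantoulidisSchulze2025_lowEntropy_sphere_four := by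
  sorry

/-- STUB 1 · LANDED (p74486): `Φ ∘ ι` is a smooth embedding into `ℝ⁵`, by name from
`Theorems/CylinderEntropySliceIsolationStubConformalEmbedding.lean`. -/
theorem stub_conformalEmbedding :
    ∀ (M : Type) [TopologicalSpace M] [T2Space M] [SecondCountableTopology M]
      [ChartedSpace (EuclideanSpace ℝ (Fin 4)) M] [IsManifold (𝓡 4) ∞ M] [CompactSpace M]
      (ι : M → EuclideanSpace ℝ (Fin 6)), Manifold.IsSmoothEmbedding (𝓡 4) (𝓡 6) ∞ ι →
      (∀ x, ∑ i : Fin 5, ι x (Fin.castSucc i) ^ 2 = 1) →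
      Manifold.IsSmoothEmbedding (𝓡 4) (𝓡 5) ∞
        ((fun z : EuclideanSpace ℝ (Fin 6) =>
          (WithLp.toLp 2 (fun i : Fin 5 => Real.exp (z 5) * z (Fin.castSucc i)) : EuclideanSpace ℝ (Fin 5))) ∘ ι) :=
  Summit.SmoothPoincare4.SmoothPoincare4.Theorems.CylinderEntropySliceIsolation.stub_conformalEmbedding

/-- STUB 2 · SLAB CONFINEMENT (lead; hardest): Hausdorff stability of the slice among low-entropy
cross-sections. For every `η > 0` there is `ε > 0` such that a compact connected smooth hypersurface of `N`
separating the ends (typed predicate of the route items) with typed cylinder entropy `≤ 1 + ε` lies in a slab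
`|z₅ − t₀| ≤ η`. [size L] -/
theorem stub_slabConfinement :
    ∀ η : ℝ, 0 < η → ∃ ε : ℝ, 0 < ε ∧
      ∀ (M : Type) [TopologicalSpace M] [T2Space M] [SecondCountableTopology M]
        [ChartedSpace (EuclideanSpace ℝ (Fin 4)) M] [IsManifold (𝓡 4) ∞ M] [CompactSpace M]
        [ConnectedSpace M] (ι : M → EuclideanSpace ℝ (Fin 6)), Manifold.IsSmoothEmbedding (𝓡 4) (𝓡 6) ∞ ι →
        (∀ x, ∑ i : Fin 5, ι x (Fin.castSucc i) ^ 2 = 1) →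
        (∃ R : ℝ, ∀ a b : EuclideanSpace ℝ (Fin 6), ∑ i : Fin 5, a (Fin.castSucc i) ^ 2 = 1 →
          ∑ i : Fin 5, b (Fin.castSucc i) ^ 2 = 1 → a 5 ≤ -R → R ≤ b 5 →
          ¬ JoinedIn ({z : EuclideanSpace ℝ (Fin 6) | ∑ i : Fin 5, z (Fin.castSucc i) ^ 2 = 1} \ Set.range ι) a b) →
        cylEntropy (Set.range ι) ≤ ENNReal.ofReal (1 + ε) →
        ∃ t₀ : ℝ, ∀ z ∈ Set.range ι, |z 5 - t₀| ≤ η := by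
  sorry

/-- STUB 3′ · NAMED CLASSICAL DEBT #2 (registered like stub 0): the Cheeger–Yau comparison for the heat kernel of the
unit `4`-sphere written for the typed zonal series, tree fact `Literature.Geometry.Riemannian.CheegerYauZonalSphereFour`
(p76567): `(8π²/3)(4πσ)⁻² e^{−arccos(c)²/4σ} ≤ zonal σ c` for `σ > 0`, `c ∈ [−1,1]` (Cheeger–Yau 1981 for `Ric ≥ 0`;
Davies, *Heat kernels and spectral theory*, Thm 5.6.1; `zonal = vol(S⁴)·K_{S⁴}` by the Gegenbauer eigen-expansion). Not a lemma
to prove here (needs the spectral theory of `Δ_{S⁴}`); the closing theorem carries it as a hypothesis by name.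
[cite: CheegerYau1981] -/
theorem stub_cheegerYauZonalSphereFour : Literature.Geometry.Riemannian.CheegerYauZonalSphereFour := by
  sorry

/-- STUB 3 · SMALL-SCALE CONFORMAL DOMINATION — PROVED MODULO the Cheeger–Yau debt (worker, p76567:
`SphericalCylinderConformal.smallScaleDomination_of_cheegerYau`, sorry-free, 3 Literature files): for every `δ > 0` there
is `t₁ > 0` such that for every measurable `A ⊆ N` in a unit slab around height `t₀`, every centre `y ∈ ℝ⁵` and every
scale `0 < t ≤ t₁ e^{2t₀}`, the Euclidean Gaussian area of `Φ(A)` is at most `(1 + δ) λ_cyl(A)`. -/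
theorem stub_smallScaleDomination :
    ∀ δ : ℝ, 0 < δ → ∃ t₁ : ℝ, 0 < t₁ ∧
      ∀ (t₀ : ℝ) (A : Set (EuclideanSpace ℝ (Fin 6))),
        A ⊆ {z : EuclideanSpace ℝ (Fin 6) | ∑ i : Fin 5, z (Fin.castSucc i) ^ 2 = 1} → MeasurableSet A →
        (∀ z ∈ A, |z 5 - t₀| ≤ 1) →
        ∀ (y : EuclideanSpace ℝ (Fin 5)) (t : ℝ), 0 < t → t ≤ t₁ * Real.exp (2 * t₀) →
          gaussianArea 4 y t
            ((fun z : EuclideanSpace ℝ (Fin 6) =>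
          (WithLp.toLp 2 (fun i : Fin 5 => Real.exp (z 5) * z (Fin.castSucc i)) : EuclideanSpace ℝ (Fin 5))) '' A) ≤
            ENNReal.ofReal (1 + δ) * cylEntropy A :=
  Literature.Geometry.Riemannian.SphericalCylinderConformal.smallScaleDomination_of_cheegerYau
    stub_cheegerYauZonalSphereFour

/-- STUB 4 · GROUND-STATE CONTINUITY (worker): for every `δ > 0` and `t₁ > 0` there are `η > 0`, `ε > 0` such
that for every measurable end-separating `A ⊆ N` in the slab of half-height `η` around `t₀` with
`μH⁴(A) ≤ (1+ε) μH⁴(S⁴)`, every centre `y` and every scale `t ≥ t₁ e^{2t₀}`, the Euclidean Gaussian area of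
`Φ(A)` is at most `λ(unit S⁴) + δ`. [size M–L] -/
theorem stub_groundStateContinuity :
    ∀ δ : ℝ, 0 < δ → ∀ t₁ : ℝ, 0 < t₁ → ∃ η : ℝ, 0 < η ∧ ∃ ε : ℝ, 0 < ε ∧
      ∀ (t₀ : ℝ) (A : Set (EuclideanSpace ℝ (Fin 6))),
        A ⊆ {z : EuclideanSpace ℝ (Fin 6) | ∑ i : Fin 5, z (Fin.castSucc i) ^ 2 = 1} → MeasurableSet A →
        (∃ R : ℝ, ∀ a b : EuclideanSpace ℝ (Fin 6), ∑ i : Fin 5, a (Fin.castSucc i) ^ 2 = 1 →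
          ∑ i : Fin 5, b (Fin.castSucc i) ^ 2 = 1 → a 5 ≤ -R → R ≤ b 5 →
          ¬ JoinedIn ({z : EuclideanSpace ℝ (Fin 6) | ∑ i : Fin 5, z (Fin.castSucc i) ^ 2 = 1} \ A) a b) →
        (∀ z ∈ A, |z 5 - t₀| ≤ η) →
        μH[4] A ≤ ENNReal.ofReal (1 + ε) * μH[4] (Metric.sphere (0 : EuclideanSpace ℝ (Fin 5)) 1) →
        ∀ (y : EuclideanSpace ℝ (Fin 5)) (t : ℝ), t₁ * Real.exp (2 * t₀) ≤ t →
          gaussianArea 4 y t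
            ((fun z : EuclideanSpace ℝ (Fin 6) =>
          (WithLp.toLp 2 (fun i : Fin 5 => Real.exp (z 5) * z (Fin.castSucc i)) : EuclideanSpace ℝ (Fin 5))) '' A) ≤
            gaussianEntropy 4 (Metric.sphere (0 : EuclideanSpace ℝ (Fin 5)) 1) + ENNReal.ofReal δ := by
  sorry

/-- STUB 5 · THE SHARP KERNEL DOMINATION `λ(Φ A) ≤ λ(S⁴) λ_cyl(A)` (worker; explicit-constant variant, OFF the
main chain). [size L; open in the regime `|y|²/τ ≈ 8–30`] -/
theorem stub_entropyDomination :
    ∀ A : Set (EuclideanSpace ℝ (Fin 6)),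
      A ⊆ {z : EuclideanSpace ℝ (Fin 6) | ∑ i : Fin 5, z (Fin.castSucc i) ^ 2 = 1} → MeasurableSet A →
      gaussianEntropy 4
          ((fun z : EuclideanSpace ℝ (Fin 6) =>
          (WithLp.toLp 2 (fun i : Fin 5 => Real.exp (z 5) * z (Fin.castSucc i)) : EuclideanSpace ℝ (Fin 5))) '' A) ≤
        gaussianEntropy 4 (Metric.sphere (0 : EuclideanSpace ℝ (Fin 5)) 1) * cylEntropy A := by
  sorry

/-! ### The registered statements are the readable ones (definitional bridges, kernel-checked) -/

/-- Registered STUB 1 is `ConformalEmbedding` verbatim up to unfolding `conformalMap`. -/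
theorem conformalEmbedding_iff_stub : ConformalEmbedding ↔ type_of% stub_conformalEmbedding := Iff.rfl

/-- Registered STUB 2 is `SlabConfinement` verbatim up to unfolding `SeparatesEnds`, `InSlab`. -/
theorem slabConfinement_iff_stub : SlabConfinement ↔ type_of% stub_slabConfinement := Iff.rfl

/-- Registered STUB 3 is `SmallScaleDomination` verbatim up to unfolding `cylN`, `InSlab`, `conformalMap`. -/
theorem smallScaleDomination_iff_stub : SmallScaleDomination ↔ type_of% stub_smallScaleDomination := Iff.rfl

/-- Registered STUB 4 is `GroundStateContinuity` verbatim up to unfolding `cylN`, `SeparatesEnds`, `InSlab`,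
`conformalMap`. -/
theorem groundStateContinuity_iff_stub : GroundStateContinuity ↔ type_of% stub_groundStateContinuity :=
  Iff.rfl

/-- Registered STUB 5 is `EntropyDomination` verbatim up to unfolding `cylN`, `conformalMap`. -/
theorem entropyDomination_iff_stub : EntropyDomination ↔ type_of% stub_entropyDomination := Iff.rfl

/-! ## Composition (sorry-free) -/

/-- `32/(3e²) + 1/100 ≤ 4/e` (the unit-scale budget: `λ(S⁴) + δ` stays below `λ(S² × ℝ²)`). -/
theorem sphereEntropy_add_le : 32 / (3 * Real.exp 1 ^ 2) + 1 / 100 ≤ 4 / Real.exp 1 := by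
  have he1 : (2.7182818283 : ℝ) < Real.exp 1 := Real.exp_one_gt_d9
  have he2 : Real.exp 1 < 2.7182818286 := Real.exp_one_lt_d9
  have he0 : 0 < Real.exp 1 := Real.exp_pos 1
  rw [div_add_div _ _ (by positivity) (by norm_num : (100 : ℝ) ≠ 0),
    div_le_div_iff₀ (by positivity) he0]
  nlinarith [mul_pos he0 he0, sq_nonneg (Real.exp 1)]

/-- `(1 + 1/100) (1 + 1/100) ≤ 4/e` (the small-scale budget). -/
theorem smallScale_budget_le : (1 + 1 / 100 : ℝ) * (1 + 1 / 100) ≤ 4 / Real.exp 1 := by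
  have he2 : Real.exp 1 < 2.7182818286 := Real.exp_one_lt_d9
  have he0 : 0 < Real.exp 1 := Real.exp_pos 1
  rw [le_div_iff₀ he0]
  nlinarith

/-- `(32/(3e²)) (3e/8) = 4/e` (the explicit threshold of the sharp variant). -/
theorem sphereEntropy_mul_threshold : 32 / (3 * Real.exp 1 ^ 2) * (3 * Real.exp 1 / 8) = 4 / Real.exp 1 := by
  have he0 : Real.exp 1 ≠ 0 := (Real.exp_pos 1).ne'
  field_simp
  ring

/-- The recognition step shared by both compositions: instances from `M ≃ₕ S⁴` (tree), `Φ ∘ ι` a smooth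
embedding (STUB 1), and the CMS fact clause (b). -/
theorem diffeomorph_of_conformal_entropy_le
    (hCMS : ChodoshMantoulidisSchulze2025_lowEntropy_sphere_four) (h₁ : ConformalEmbedding)
    (M : Type) [TopologicalSpace M] [T2Space M] [SecondCountableTopology M]
    [ChartedSpace (EuclideanSpace ℝ (Fin 4)) M] [IsManifold (𝓡 4) ∞ M]
    (e : M ≃ₕ Metric.sphere (0 : E5) 1) (ι : M → E6)
    (hι : Manifold.IsSmoothEmbedding (𝓡 4) (𝓡 6) ∞ ι) (hN : ∀ x, ∑ i : Fin 5, ι x (Fin.castSucc i) ^ 2 = 1)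
    (hbound : gaussianEntropy 4 (conformalMap '' Set.range ι) ≤ gaussianEntropy 4 (shrinkingCylinder 4 2)) :
    Nonempty (M ≃ₘ⟮𝓡 4, 𝓡 4⟯ Metric.sphere (0 : E5) 1) := by
  haveI : CompactSpace M :=
    Literature.Topology.FourManifolds.compactSpace_of_homotopyEquiv_sphere_four_holds M e
  haveI : PathConnectedSpace M := by
    haveI := Literature.Topology.FourManifolds.pathConnectedSpace_sphere_four
    exact Literature.Topology.FourManifolds.pathConnectedSpace_of_homotopyEquiv e
  have hsc : SimplyConnectedSpace M :=
    Literature.Topology.FourManifolds.simplyConnectedSpace_of_homotopyEquiv_sphere_four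
      Literature.Topology.FourManifolds.simplyConnectedSpace_sphere_four_holds M e
  have hemb : Manifold.IsSmoothEmbedding (𝓡 4) (𝓡 5) ∞ (conformalMap ∘ ι) := h₁ M ι hι hN
  refine hCMS.of_le_shrinkingCylinder_two M hsc hemb ?_
  rwa [Set.range_comp]

/-- **Main composition (kernel-checked; no sorry in this proof).** The crux — written READABLY with the
tree's `cylEntropy` and this file's `SeparatesEnds`, which is the route decl `SliceIsolation` up to
unfolding definitions (see `SliceIsolation_of`) — from the CMS named fact (hypothesis, by name) and
STUBS 1–4, with `ε := min (min ε_unit ε_slab) (1/100)` where `t₁ := t₁(1/100)` (STUB 3),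
`(η, ε_unit) := (η, ε)(1/100, t₁)` (STUB 4), `ε_slab := ε(min η 1)` (STUB 2). This is the shape of the
lead's eventual closing theorem (`(h : ChodoshMantoulidisSchulze2025_lowEntropy_sphere_four) → crux`). -/
theorem sliceIsolation_of_parts (hCMS : ChodoshMantoulidisSchulze2025_lowEntropy_sphere_four)
    (h₁ : ConformalEmbedding) (h₂ : SlabConfinement) (h₃ : SmallScaleDomination)
    (h₄ : GroundStateContinuity) :
    ∃ ε : ℝ, 0 < ε ∧ ∀ (M : Type) [TopologicalSpace M] [T2Space M] [SecondCountableTopology M]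
      [ChartedSpace (EuclideanSpace ℝ (Fin 4)) M] [IsManifold (𝓡 4) ∞ M],
      M ≃ₕ Metric.sphere (0 : E5) 1 → ∀ ι : M → E6, Manifold.IsSmoothEmbedding (𝓡 4) (𝓡 6) ∞ ι →
      (∀ x, ∑ i : Fin 5, ι x (Fin.castSucc i) ^ 2 = 1) → SeparatesEnds (Set.range ι) →
      cylEntropy (Set.range ι) < ENNReal.ofReal (1 + ε) →
      Nonempty (M ≃ₘ⟮𝓡 4, 𝓡 4⟯ Metric.sphere (0 : E5) 1) := by
  -- the constants of the line
  obtain ⟨t₁, ht₁, Hsmall⟩ := h₃ (1 / 100) (by norm_num)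
  obtain ⟨η, hη, εu, hεu, Hunit⟩ := h₄ (1 / 100) (by norm_num) t₁ ht₁
  obtain ⟨εs, hεs, Hslab⟩ := h₂ (min η 1) (lt_min hη one_pos)
  refine ⟨min (min εu εs) (1 / 100), lt_min (lt_min hεu hεs) (by norm_num), ?_⟩
  intro M _ _ _ _ _ e ι hι hN hsep' hent'
  -- instances from `M ≃ₕ S⁴` (PROVED in the tree)
  haveI : CompactSpace M :=
    Literature.Topology.FourManifolds.compactSpace_of_homotopyEquiv_sphere_four_holds M e
  haveI : PathConnectedSpace M := by
    haveI := Literature.Topology.FourManifolds.pathConnectedSpace_sphere_four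
    exact Literature.Topology.FourManifolds.pathConnectedSpace_of_homotopyEquiv e
  -- the cross-section as a subset of `N`
  set A : Set E6 := Set.range ι with hA
  have hAN : A ⊆ cylN := by
    rintro _ ⟨x, rfl⟩
    exact hN x
  have hAm : MeasurableSet A :=
    (isCompact_range hι.isEmbedding.continuous).isClosed.measurableSet
  have hε_u : min (min εu εs) (1 / 100) ≤ εu := (min_le_left _ _).trans (min_le_left _ _)
  have hε_s : min (min εu εs) (1 / 100) ≤ εs := (min_le_left _ _).trans (min_le_right _ _)
  have hε_c : min (min εu εs) (1 / 100) ≤ 1 / 100 := min_le_right _ _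
  have hent_u : cylEntropy A ≤ ENNReal.ofReal (1 + εu) :=
    hent'.le.trans (ENNReal.ofReal_le_ofReal (by linarith))
  have hent_s : cylEntropy A ≤ ENNReal.ofReal (1 + εs) :=
    hent'.le.trans (ENNReal.ofReal_le_ofReal (by linarith))
  have hent_c : cylEntropy A ≤ ENNReal.ofReal (1 + 1 / 100) :=
    hent'.le.trans (ENNReal.ofReal_le_ofReal (by linarith))
  -- STUB 2: the cross-section lies in a thin slab around some height `t₀`
  obtain ⟨t₀, hslab'⟩ := Hslab M ι hι hN hsep' hent_s
  have hslabη : InSlab A t₀ η := fun z hz => (hslab' z hz).trans (min_le_left _ _)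
  have hslab1 : InSlab A t₀ 1 := fun z hz => (hslab' z hz).trans (min_le_right _ _)
  -- area budget from the tree (`measure_ratio_le_cylEntropy`, bounded height from the slab)
  have hS0 : μH[4] (Metric.sphere (0 : E5) 1) ≠ 0 := hausdorffMeasure_sphere_four_pos.ne'
  have hStop : μH[4] (Metric.sphere (0 : E5) 1) ≠ ⊤ := hausdorffMeasure_sphere_four_lt_top.ne
  have hB : ∀ z ∈ A, |z 5| ≤ |t₀| + 1 := by
    intro z hz
    have h1 := hslab1 z hz
    calc |z 5| = |(z 5 - t₀) + t₀| := by ring_nf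
      _ ≤ |z 5 - t₀| + |t₀| := abs_add_le _ _
      _ ≤ |t₀| + 1 := by linarith
  have hratio : (μH[4] (Metric.sphere (0 : E5) 1))⁻¹ * μH[4] A ≤ ENNReal.ofReal (1 + εu) :=
    (measure_ratio_le_cylEntropy hAm (fun z hz => hAN hz) hB).trans hent_u
  have harea : μH[4] A ≤ ENNReal.ofReal (1 + εu) * μH[4] (Metric.sphere (0 : E5) 1) := by
    calc μH[4] A = μH[4] (Metric.sphere (0 : E5) 1) * ((μH[4] (Metric.sphere (0 : E5) 1))⁻¹ * μH[4] A) := by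
          rw [← mul_assoc, ENNReal.mul_inv_cancel hS0 hStop, one_mul]
      _ ≤ μH[4] (Metric.sphere (0 : E5) 1) * ENNReal.ofReal (1 + εu) := by gcongr
      _ = ENNReal.ofReal (1 + εu) * μH[4] (Metric.sphere (0 : E5) 1) := mul_comm _ _
  -- the Euclidean entropy of `Φ(A)` is at most `4/e = λ(S² × ℝ²)`
  have hbound : gaussianEntropy 4 (conformalMap '' A) ≤ gaussianEntropy 4 (shrinkingCylinder 4 2) := by
    rw [gaussianEntropy_shrinkingCylinder_four_two, gaussianEntropy_eq_iSup]
    refine iSup_le fun y => iSup_le fun t => iSup_le fun ht => ?_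
    rcases le_or_gt t (t₁ * Real.exp (2 * t₀)) with hle | hgt
    · -- small scales: STUB 3
      calc gaussianArea 4 y t (conformalMap '' A)
          ≤ ENNReal.ofReal (1 + 1 / 100) * cylEntropy A := Hsmall t₀ A hAN hAm hslab1 y t ht hle
        _ ≤ ENNReal.ofReal (1 + 1 / 100) * ENNReal.ofReal (1 + 1 / 100) := by gcongr
        _ = ENNReal.ofReal ((1 + 1 / 100) * (1 + 1 / 100)) := (ENNReal.ofReal_mul (by norm_num)).symm
        _ ≤ ENNReal.ofReal (4 / Real.exp 1) := ENNReal.ofReal_le_ofReal smallScale_budget_le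
    · -- unit and large scales: STUB 4
      calc gaussianArea 4 y t (conformalMap '' A)
          ≤ gaussianEntropy 4 (Metric.sphere (0 : E5) 1) + ENNReal.ofReal (1 / 100) :=
            Hunit t₀ A hAN hAm hsep' hslabη harea y t hgt.le
        _ = ENNReal.ofReal (32 / (3 * Real.exp 1 ^ 2) + 1 / 100) := by
            rw [gaussianEntropy_sphere_four (0 : E5) one_pos, ← ENNReal.ofReal_add (by positivity) (by norm_num)]
        _ ≤ ENNReal.ofReal (4 / Real.exp 1) := ENNReal.ofReal_le_ofReal sphereEntropy_add_le
  exact diffeomorph_of_conformal_entropy_le hCMS h₁ M e ι hι hN hbound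

/-- **The skeleton concludes the crux BY NAME.** `CylinderEntropy.SliceIsolation`
(stmt-SmoothPoincare4-7632) from the registered stubs of the main chain: STUB 0 (the CMS named fact, by
name) and STUBS 1–4. -/
theorem SliceIsolation_of : SliceIsolation :=
  -- the route decl unfolds to the readable statement of `sliceIsolation_of_parts`
  -- (`cylEntropy`, `SeparatesEnds`, `cylN` are the typed expressions verbatim)
  sliceIsolation_of_parts stub_cmsLowEntropySphereFour stub_conformalEmbedding stub_slabConfinement
    stub_smallScaleDomination stub_groundStateContinuity

/-- **Sharp variant (alternative composition, explicit constant).** `SliceIsolation` with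
`1 + ε = 3e/8` from the CMS fact, STUB 1 and STUB 5 (`EntropyDomination`):
`λ(Φ(range ι)) ≤ λ(S⁴) λ_cyl < (32/(3e²)) (3e/8) = 4/e`. -/
theorem sliceIsolation_of_domination (hCMS : ChodoshMantoulidisSchulze2025_lowEntropy_sphere_four)
    (h₁ : ConformalEmbedding) (h₅ : EntropyDomination) : SliceIsolation := by
  have he1 : (2.7182818283 : ℝ) < Real.exp 1 := Real.exp_one_gt_d9
  refine ⟨3 * Real.exp 1 / 8 - 1, by linarith, ?_⟩
  intro M _ _ _ _ _ e ι hι hN hsep hent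
  haveI : CompactSpace M :=
    Literature.Topology.FourManifolds.compactSpace_of_homotopyEquiv_sphere_four_holds M e
  set A : Set E6 := Set.range ι with hA
  have hent' : cylEntropy A < ENNReal.ofReal (1 + (3 * Real.exp 1 / 8 - 1)) := hent
  have hAN : A ⊆ cylN := by
    rintro _ ⟨x, rfl⟩
    exact hN x
  have hAm : MeasurableSet A :=
    (isCompact_range hι.isEmbedding.continuous).isClosed.measurableSet
  have hbound : gaussianEntropy 4 (conformalMap '' A) ≤ gaussianEntropy 4 (shrinkingCylinder 4 2) := by
    calc gaussianEntropy 4 (conformalMap '' A)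
        ≤ gaussianEntropy 4 (Metric.sphere (0 : E5) 1) * cylEntropy A := h₅ A hAN hAm
      _ ≤ gaussianEntropy 4 (Metric.sphere (0 : E5) 1) * ENNReal.ofReal (1 + (3 * Real.exp 1 / 8 - 1)) := by
          gcongr
      _ = ENNReal.ofReal (4 / Real.exp 1) := by
          rw [gaussianEntropy_sphere_four (0 : E5) one_pos, ← ENNReal.ofReal_mul (by positivity),
            show (1 + (3 * Real.exp 1 / 8 - 1)) = 3 * Real.exp 1 / 8 by ring, sphereEntropy_mul_threshold]
      _ = gaussianEntropy 4 (shrinkingCylinder 4 2) := gaussianEntropy_shrinkingCylinder_four_two.symm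
  exact diffeomorph_of_conformal_entropy_le hCMS h₁ M e ι hι hN hbound

/-- The sharp variant from the registered stubs 0, 1 and 5 (crux BY NAME). -/
theorem SliceIsolation_of_domination : SliceIsolation :=
  sliceIsolation_of_domination stub_cmsLowEntropySphereFour stub_conformalEmbedding stub_entropyDomination

end Summit.SmoothPoincare4.SmoothPoincare4.Cruxes.SliceIsolation.ConformalKernelDomination

end
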